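import Summits.CriticalPhenomena.PercolationContinuityZ3.Theorems.PercNearOneGluingNoHeavyPcintBSMRZ4RChkR1
import HarnessLib

/-!
# PCINT lane, PHASE 9 (block renewal with reach-3 pieces): kernel checks 2/4 of the checkpoint chain for `ℤ^4`

Cell `prim-pcint`, seat `prim-pcint-1` (gen 17); memo `run/shared/lean/prim/pcint/T-FIBRE-ROUTE.md` §PHASE 9.
Instance `Z4R`: `d = 4 = 2 + 2` (`k = 2` time axes, the transverse plane), bond percolation, reach-3 pieces,
7-point law `A/DA = [15, 40, 150, 590, 150, 40, 15]/1000`, horizon `N = 1000` (window half-width `200`), Fourier tail (cut-off data,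
`θ₀ = 1/3`) `T = 3447475577/10^12`, cell `p = 2515/10^4`. `rowLE (hrowFrom starts[c] (2L)) starts[c+1]`.
-/

namespace Summit.CriticalPhenomena.PercolationContinuityZ3.Theorems.Pcint.BSMR.Z4R

open Summit.CriticalPhenomena.PercolationContinuityZ3.Theorems.Pcint.BSMR Summit.CriticalPhenomena.PercolationContinuityZ3.Theorems.Pcint.BSMX Summit.CriticalPhenomena.PercolationContinuityZ3.Theorems.Pcint.BSM

set_option maxHeartbeats 0 in
set_option maxRecDepth 65536 in
/-- Checkpoint `6` dominates the rows continued from checkpoint `5`. -/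
theorem hn_5 : ∀ c ∈ (((List.range 19).drop 5).take 1),
    BSMX.rowLE (hrowFrom 3 lawA 1000 1000000000000 (starts.getD c []) (2 * 50)) (starts.getD (c + 1) []) = true := by
  decide +kernel

set_option maxHeartbeats 0 in
set_option maxRecDepth 65536 in
/-- Checkpoint `7` dominates the rows continued from checkpoint `6`. -/
theorem hn_6 : ∀ c ∈ (((List.range 19).drop 6).take 1),
    BSMX.rowLE (hrowFrom 3 lawA 1000 1000000000000 (starts.getD c []) (2 * 50)) (starts.getD (c + 1) []) = true := by
  decide +kernel

set_option maxHeartbeats 0 in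
set_option maxRecDepth 65536 in
/-- Checkpoint `8` dominates the rows continued from checkpoint `7`. -/
theorem hn_7 : ∀ c ∈ (((List.range 19).drop 7).take 1),
    BSMX.rowLE (hrowFrom 3 lawA 1000 1000000000000 (starts.getD c []) (2 * 50)) (starts.getD (c + 1) []) = true := by
  decide +kernel

set_option maxHeartbeats 0 in
set_option maxRecDepth 65536 in
/-- Checkpoint `9` dominates the rows continued from checkpoint `8`. -/
theorem hn_8 : ∀ c ∈ (((List.range 19).drop 8).take 1),
    BSMX.rowLE (hrowFrom 3 lawA 1000 1000000000000 (starts.getD c []) (2 * 50)) (starts.getD (c + 1) []) = true := by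
  decide +kernel

set_option maxHeartbeats 0 in
set_option maxRecDepth 65536 in
/-- Checkpoint `10` dominates the rows continued from checkpoint `9`. -/
theorem hn_9 : ∀ c ∈ (((List.range 19).drop 9).take 1),
    BSMX.rowLE (hrowFrom 3 lawA 1000 1000000000000 (starts.getD c []) (2 * 50)) (starts.getD (c + 1) []) = true := by
  decide +kernel


end Summit.CriticalPhenomena.PercolationContinuityZ3.Theorems.Pcint.BSMR.Z4R
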